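import Summits.CriticalPhenomena.PercolationContinuityZ3.Theorems.PercNearOneGluingNoHeavyLowerTailSahiStrongCubicPlusCertCheck
import Summits.CriticalPhenomena.PercolationContinuityZ3.Theorems.PercNearOneGluingNoHeavyLowerTailSahiCombPrincipalCoSunflower
import Summits.CriticalPhenomena.PercolationContinuityZ3.Theorems.PercNearOneGluingNoHeavyLowerTailSahiCombPrincipalCoSunflowerPadding

/-!
# `NoHeavyLowerTail` (crux stmt-CriticalPhenomena-4575), master-family line P1 (gen 21):
# **S₃⁺ `(κ+o)(κo − e₂) ≥ e₃` — hence S₃ and the class law — for the co-sunflower of EVERY triple of principal up-sets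
# (and of intersections of independent events), at every product measure, IN THE KERNEL**

Support file (seat `prim-masterthm-p1`, gen 21; `--supports stmt-CriticalPhenomena-4575`).  No definition, no `sorry`, standard axioms.
Memo `run/shared/lean/prim/prim-masterthm/FROM-prim-masterthm-p1-g21-PRODUCT-FORM-AND-PRINCIPAL-CLASS.md` §2.

TEMPLATE METHOD at the measure level.  The sandwiched triple `(G₁∪G₂, G₀∪G₂, G₀∪G₁)` for `G_k = ⋂_{a∈A_k} H_a` over an independent family
`(H_a)` is the preimage of the SEVEN-COIN base triple `base_k = {ξ | ∃ j ≠ k, ξ ⊇ S_j}` (`…SahiCombPrincipalCoSunflower`) under the gadget map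
`φ(ω) = {r | ω ∈ G r}`; the image of `μ_q` under `φ` is the product weight with biases `c_r = μ_q(G r)` (`pushWeight_readOnce`), so EVERY cell mass — hence
`strongCubicPlus` — of the composite at `q` equals that of the base at `c` (`strongCubicPlus_readOnce`).  The base passes gen 21's S₃⁺ digit test
(`checkS3P 26 7`, `decide +kernel`: all `4^7` CP3⁺ vertex values `(Φ_A+Φ_B−T)(c) ≥ 0`), so S₃⁺ holds for the base at every bias
(`strongCubicPlus_nonneg_coBase`) and therefore for the whole class:
* **`strongCubicPlus_nonneg_coSunflower_inters`**, **`strongCubicPlus_nonneg_principal`** (`b : Fin 3 → Finset ι`: the triple `(⋃_{j≠k} ↑b_j)_k`);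
* corollaries `strongCubic_nonneg_principal` (S₃: `κo − e₂ ≥ e₃`) and `sahiE_three_nonneg_principal'` (the class law again, now via S₃⁺; the comb-level
  version is `SahiCombVenn.combPos_sahiE_three_principal`).
HONEST FRAMING: one more proved stratum of the seat's conjecture S₃⁺ (the first defined by generator type with arbitrary overlaps, and a class of
MIXED systems in the sense of gen 20); S₃⁺ / CP3⁺ in general remain OPEN. [this work]
-/

noncomputable section

open scoped Classical

namespace Summit.CriticalPhenomena.PercolationContinuityZ3.Theorems

namespace SahiS3PlusCert

-- gen 25 re-file of p385485: the up-set lemma is `SahiCombVenn.isUpperSet_coPrincipal'` of `…SahiCombPrincipalCoSunflowerPadding` (dedup).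

open Finset Function MeasureTheory
open OneCutCert CovTransferCert SahiC3Cube SahiDeepCore SahiCombVenn SahiCombReadOnce
open Literature.Combinatorics.Sahi2008
open Literature.Probability.LatticeModels (prodBernoulli)
open Literature.Probability.Percolation (DeterminedBy determinedBy_iff determinedBy_univ)
open Literature.Probability.Percolation.DecisionTree (ind ind_of_mem ind_of_not_mem ind_nonneg)
open Literature.Probability.Percolation.BHK2006 (weight)

local notation3 (prettyPrint := false) "m⟦" p ", " X "⟧" => ex (bernoulliWeight p) (ind X)

/-! ### Co-families are sandwiched -/

/-- For any three predicates, the "co-family" `M_k = {x | ∃ j ≠ k, P j x}` is a sandwiched triple: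
`M₀ ∖ M₁ ⊆ M₂`, `M₁ ∖ M₀ ⊆ M₂`, `M₂ ⊆ M₀ ∪ M₁`. [this work] -/
theorem coFamily_sandwich {α : Type*} (P : Fin 3 → α → Prop) :
    ({x | ∃ j : Fin 3, j ≠ 0 ∧ P j x} \ {x | ∃ j : Fin 3, j ≠ 1 ∧ P j x} ⊆ {x | ∃ j : Fin 3, j ≠ 2 ∧ P j x}) ∧
    ({x | ∃ j : Fin 3, j ≠ 1 ∧ P j x} \ {x | ∃ j : Fin 3, j ≠ 0 ∧ P j x} ⊆ {x | ∃ j : Fin 3, j ≠ 2 ∧ P j x}) ∧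
    ({x | ∃ j : Fin 3, j ≠ 2 ∧ P j x} ⊆ {x | ∃ j : Fin 3, j ≠ 0 ∧ P j x} ∪ {x | ∃ j : Fin 3, j ≠ 1 ∧ P j x}) := by
  refine ⟨?_, ?_, ?_⟩
  · rintro x ⟨⟨j, hj, hP⟩, hx⟩
    simp only [Set.mem_setOf_eq, not_exists, not_and] at hx
    fin_cases j
    · exact absurd rfl hj
    · exact ⟨1, by decide, hP⟩
    · exact absurd hP (hx 2 (by decide))
  · rintro x ⟨⟨j, hj, hP⟩, hx⟩
    simp only [Set.mem_setOf_eq, not_exists, not_and] at hx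
    fin_cases j
    · exact ⟨0, by decide, hP⟩
    · exact absurd rfl hj
    · exact absurd hP (hx 2 (by decide))
  · rintro x ⟨j, hj, hP⟩
    fin_cases j
    · exact Or.inr ⟨0, by decide, hP⟩
    · exact Or.inl ⟨1, by decide, hP⟩
    · exact absurd rfl hj

/-! ### The base certificate -/

/-- **The seven-coin S₃⁺ certificate** (kernel `decide`): the digit test `checkS3P 26 7` passes on the base triple — all `4^7` three-copy fibre sums
of `(κ+o)(κo−e₂)−e₃` (the CP3⁺ vertex values) are nonnegative. [this work] -/
theorem checkS3P_coBase :
    checkS3P 26 7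
      (encA 7 {ξ : Set (Fin 7) | ∃ j : Fin 3, j ≠ (0 : Fin 3) ∧ ∀ r : Fin 7, (r.1 + 1).testBit j = true → r ∈ ξ})
      (encA 7 {ξ : Set (Fin 7) | ∃ j : Fin 3, j ≠ (1 : Fin 3) ∧ ∀ r : Fin 7, (r.1 + 1).testBit j = true → r ∈ ξ})
      (encA 7 {ξ : Set (Fin 7) | ∃ j : Fin 3, j ≠ (2 : Fin 3) ∧ ∀ r : Fin 7, (r.1 + 1).testBit j = true → r ∈ ξ}) = true := by
  rw [encA_coBase, encA_coBase, encA_coBase]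
  decide +kernel

/-- **S₃⁺ for the base system at every bias vector** `c : Fin 7 → [0,1]`. [this work] -/
theorem strongCubicPlus_nonneg_coBase (c : Fin 7 → unitInterval) :
    0 ≤ strongCubicPlus c
      {ξ : Set (Fin 7) | ∃ j : Fin 3, j ≠ (0 : Fin 3) ∧ ∀ r : Fin 7, (r.1 + 1).testBit j = true → r ∈ ξ}
      {ξ : Set (Fin 7) | ∃ j : Fin 3, j ≠ (1 : Fin 3) ∧ ∀ r : Fin 7, (r.1 + 1).testBit j = true → r ∈ ξ}
      {ξ : Set (Fin 7) | ∃ j : Fin 3, j ≠ (2 : Fin 3) ∧ ∀ r : Fin 7, (r.1 + 1).testBit j = true → r ∈ ξ} := by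
  obtain ⟨hAB, hBA, hN⟩ := coFamily_sandwich (fun (j : Fin 3) (ξ : Set (Fin 7)) => ∀ r : Fin 7, (r.1 + 1).testBit j = true → r ∈ ξ)
  exact strongCubicPlus_nonneg_of_checkS3P c hAB hBA hN checkS3P_coBase

/-! ### Measure-level read-once transfer of `strongCubicPlus` -/

variable {ι κ : Type} [Fintype ι] [Fintype κ]

/-- **Masses of preimages under the gadget map are masses under the pushed-forward product weight**:
`μ_q{ω | φ ω ∈ Y} = μ_c(Y)` with `c_e = μ_q(G e)`, for gadgets on the disjoint fibres of `π`. [this work] -/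
theorem mass_readOnce (π : ι → κ) (G : κ → Set (Set ι)) (hG : ∀ e, DeterminedBy (G e) {i | π i = e}) (q : ι → unitInterval)
    (Y : Set (Set κ)) :
    m⟦q, {ω : Set ι | {e | ω ∈ G e} ∈ Y}⟧ =
      ex (bernoulliWeight fun e => (⟨(prodBernoulli q).real (G e), measureReal_nonneg, measureReal_le_one⟩ : unitInterval)) (ind Y) := by
  have hw : (weight fun e => (prodBernoulli q).real (G e)) =
      bernoulliWeight fun e => (⟨(prodBernoulli q).real (G e), measureReal_nonneg, measureReal_le_one⟩ : unitInterval) := rfl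
  have hcomp : ind {ω : Set ι | {e | ω ∈ G e} ∈ Y} = ind Y ∘ fun ω : Set ι => {e | ω ∈ G e} := by
    funext ω
    by_cases h : {e | ω ∈ G e} ∈ Y
    · rw [ind_of_mem (show ω ∈ {ω : Set ι | {e | ω ∈ G e} ∈ Y} from h), Function.comp_apply, ind_of_mem h]
    · rw [ind_of_not_mem (show ω ∉ {ω : Set ι | {e | ω ∈ G e} ∈ Y} from h), Function.comp_apply, ind_of_not_mem h]
  rw [hcomp, ← ex_pushWeight, pushWeight_readOnce π G hG q, hw]

/-- **`strongCubicPlus` is invariant under read-once substitution**: for gadgets on the disjoint fibres of `π` and any triple `(A,B,N)` of the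
gadget cube, `strongCubicPlus q (φ⁻¹A) (φ⁻¹B) (φ⁻¹N) = strongCubicPlus c A B N`, `c_e = μ_q(G e)`. [this work] -/
theorem strongCubicPlus_readOnce (π : ι → κ) (G : κ → Set (Set ι)) (hG : ∀ e, DeterminedBy (G e) {i | π i = e}) (q : ι → unitInterval)
    (A B N : Set (Set κ)) :
    strongCubicPlus q {ω : Set ι | {e | ω ∈ G e} ∈ A} {ω : Set ι | {e | ω ∈ G e} ∈ B} {ω : Set ι | {e | ω ∈ G e} ∈ N} =
      strongCubicPlus (fun e => (⟨(prodBernoulli q).real (G e), measureReal_nonneg, measureReal_le_one⟩ : unitInterval)) A B N := by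
  have e1 : {ω : Set ι | {e | ω ∈ G e} ∈ A} \ {ω : Set ι | {e | ω ∈ G e} ∈ B} = {ω : Set ι | {e | ω ∈ G e} ∈ A \ B} := by
    ext ω; simp only [Set.mem_sdiff, Set.mem_setOf_eq]
  have e2 : {ω : Set ι | {e | ω ∈ G e} ∈ B} \ {ω : Set ι | {e | ω ∈ G e} ∈ A} = {ω : Set ι | {e | ω ∈ G e} ∈ B \ A} := by
    ext ω; simp only [Set.mem_sdiff, Set.mem_setOf_eq]
  have e3 : {ω : Set ι | {e | ω ∈ G e} ∈ A} ∩ {ω : Set ι | {e | ω ∈ G e} ∈ B} ∩ {ω : Set ι | {e | ω ∈ G e} ∈ N} =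
      {ω : Set ι | {e | ω ∈ G e} ∈ A ∩ B ∩ N} := by
    ext ω; simp only [Set.mem_inter_iff, Set.mem_setOf_eq]
  have e4 : ({ω : Set ι | {e | ω ∈ G e} ∈ A} ∩ {ω : Set ι | {e | ω ∈ G e} ∈ B}) \ {ω : Set ι | {e | ω ∈ G e} ∈ N} =
      {ω : Set ι | {e | ω ∈ G e} ∈ (A ∩ B) \ N} := by
    ext ω; simp only [Set.mem_sdiff, Set.mem_inter_iff, Set.mem_setOf_eq]
  have e5 : ({ω : Set ι | {e | ω ∈ G e} ∈ A} ∪ {ω : Set ι | {e | ω ∈ G e} ∈ B})ᶜ = {ω : Set ι | {e | ω ∈ G e} ∈ (A ∪ B)ᶜ} := by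
    ext ω; simp only [Set.mem_compl_iff, Set.mem_union, Set.mem_setOf_eq]
  simp only [strongCubicPlus]
  rw [e1, e2, e3, e4, e5]
  simp only [mass_readOnce π G hG q]

/-- S₃⁺ for every read-once substitution of the base. [this work] -/
theorem strongCubicPlus_nonneg_coVenn (π : ι → Fin 7) (G : Fin 7 → Set (Set ι)) (hG : ∀ r, DeterminedBy (G r) {i | π i = r})
    (q : ι → unitInterval) :
    0 ≤ strongCubicPlus q
      (⋃ (j : Fin 3) (_ : j ≠ 0), ⋂ (r : Fin 7) (_ : (r.1 + 1).testBit j = true), G r)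
      (⋃ (j : Fin 3) (_ : j ≠ 1), ⋂ (r : Fin 7) (_ : (r.1 + 1).testBit j = true), G r)
      (⋃ (j : Fin 3) (_ : j ≠ 2), ⋂ (r : Fin 7) (_ : (r.1 + 1).testBit j = true), G r) := by
  rw [← readOnce_coBase G 0, ← readOnce_coBase G 1, ← readOnce_coBase G 2, strongCubicPlus_readOnce π G hG q]
  exact strongCubicPlus_nonneg_coBase _

/-! ### Intersections of an independent family; principal up-sets -/

section Inters

variable {A : Type} [Fintype A]

omit [Fintype ι] [Fintype A] in
/-- Venn coding: with `code a = Σ 2^k [a ∈ A_k]` and gadgets `G r = ⋂_{code a = r+1} H_a`, the member intersections are intersections of gadgets: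
`⋂_{a ∈ A_j} H_a = ⋂_{r : j ∈ code(r+1)} G r`. [this work] -/
theorem iInter_mem_eq_iInter_code (H : A → Set (Set ι)) (𝒜 : Fin 3 → Finset A) (j : Fin 3) :
    (⋂ a ∈ 𝒜 j, H a) =
      ⋂ (r : Fin 7) (_ : (r.1 + 1).testBit j = true),
        ⋂ (a : A) (_ : ((if a ∈ 𝒜 0 then 1 else 0) + (if a ∈ 𝒜 1 then 2 else 0) + (if a ∈ 𝒜 2 then 4 else 0)) = r.1 + 1), H a := by
  have hcode7 : ∀ a, (if a ∈ 𝒜 0 then 1 else 0) + (if a ∈ 𝒜 1 then 2 else 0) + (if a ∈ 𝒜 2 then 4 else 0) ≤ 7 :=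
    fun a => code_le 𝒜 a
  have hbit : ∀ a (k : Fin 3), ((if a ∈ 𝒜 0 then 1 else 0) + (if a ∈ 𝒜 1 then 2 else 0) + (if a ∈ 𝒜 2 then 4 else 0)).testBit k
      = true ↔ a ∈ 𝒜 k := fun a k => testBit_code 𝒜 a k
  ext ω
  simp only [Set.mem_iInter]
  constructor
  · intro hω r hr a hca
    exact hω a ((hbit a j).1 (by rw [hca]; exact hr))
  · intro hω a ha
    have hca : ((if a ∈ 𝒜 0 then 1 else 0) + (if a ∈ 𝒜 1 then 2 else 0) + (if a ∈ 𝒜 2 then 4 else 0)).testBit j = true :=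
      (hbit a j).2 ha
    have hca0 : (if a ∈ 𝒜 0 then 1 else 0) + (if a ∈ 𝒜 1 then 2 else 0) + (if a ∈ 𝒜 2 then 4 else 0) ≠ 0 := fun h0 => by
      rw [h0] at hca; simp at hca
    set cd := (if a ∈ 𝒜 0 then 1 else 0) + (if a ∈ 𝒜 1 then 2 else 0) + (if a ∈ 𝒜 2 then 4 else 0) with hcd
    have e : cd - 1 + 1 = cd := by omega
    have hr : ((⟨cd - 1, by have := hcode7 a; omega⟩ : Fin 7).1 + 1).testBit j = true := by
      show (cd - 1 + 1).testBit j = true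
      rw [e]; exact hca
    exact hω ⟨cd - 1, by have := hcode7 a; omega⟩ hr a (by show cd = cd - 1 + 1; omega)

/-- **S₃⁺ FOR CO-SUNFLOWERS OF INTERSECTIONS OF INDEPENDENT EVENTS**: `(H_a)` with pairwise disjoint determining sets, `G_k = ⋂_{A_k} H_a`; then
`(κ+o)(κo−e₂) ≥ e₃` for the sandwiched triple `(G₁∪G₂, G₀∪G₂, G₀∪G₁)` at every product measure. [this work] -/
theorem strongCubicPlus_nonneg_coSunflower_inters (q : ι → unitInterval) (H : A → Set (Set ι)) (D : A → Finset ι)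
    (hD : ∀ a b, a ≠ b → Disjoint (D a) (D b)) (hH : ∀ a, DeterminedBy (H a) (↑(D a) : Set ι)) (𝒜 : Fin 3 → Finset A) :
    0 ≤ strongCubicPlus q
      (⋃ (j : Fin 3) (_ : j ≠ 0), ⋂ a ∈ 𝒜 j, H a) (⋃ (j : Fin 3) (_ : j ≠ 1), ⋂ a ∈ 𝒜 j, H a) (⋃ (j : Fin 3) (_ : j ≠ 2), ⋂ a ∈ 𝒜 j, H a) := by
  classical
  let code : A → ℕ := fun a => (if a ∈ 𝒜 0 then 1 else 0) + (if a ∈ 𝒜 1 then 2 else 0) + (if a ∈ 𝒜 2 then 4 else 0)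
  have hcode7 : ∀ a, code a ≤ 7 := fun a => code_le 𝒜 a
  let π : ι → Fin 7 := fun i =>
    if h : ∃ a, i ∈ D a ∧ code a ≠ 0 then ⟨code h.choose - 1, by have := hcode7 h.choose; omega⟩ else 0
  let G : Fin 7 → Set (Set ι) := fun r => ⋂ (a : A) (_ : code a = r.1 + 1), H a
  have howner : ∀ {i a}, i ∈ D a → code a ≠ 0 → π i = ⟨code a - 1, by have := hcode7 a; omega⟩ := by
    intro i a hi hca
    have hex : ∃ a, i ∈ D a ∧ code a ≠ 0 := ⟨a, hi, hca⟩
    have hπ : π i = ⟨code hex.choose - 1, by have := hcode7 hex.choose; omega⟩ := dif_pos hex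
    have ha : hex.choose = a := by
      by_contra hne
      exact Finset.disjoint_left.1 (hD _ _ hne) hex.choose_spec.1 hi
    rw [hπ]; exact Fin.ext (by simp only [ha])
  have hG : ∀ r, DeterminedBy (G r) {i | π i = r} := by
    intro r
    rw [determinedBy_iff]
    intro ω ω' hωω'
    simp only [G, Set.mem_iInter]
    refine forall_congr' fun a => forall_congr' fun hca => ?_
    refine (determinedBy_iff _ _).1 (hH a) ω ω' ?_
    have hsub : (↑(D a) : Set ι) ⊆ {i | π i = r} := fun i hi => by
      have hca0 : code a ≠ 0 := by omega
      simp only [Set.mem_setOf_eq, howner (Finset.mem_coe.1 hi) hca0]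
      exact Fin.ext (by simp only [hca]; omega)
    rw [← Set.inter_eq_self_of_subset_right hsub, ← Set.inter_assoc, ← Set.inter_assoc, hωω']
  have h := strongCubicPlus_nonneg_coVenn π G hG q
  have e : ∀ j : Fin 3, (⋂ a ∈ 𝒜 j, H a) = ⋂ (r : Fin 7) (_ : (r.1 + 1).testBit j = true), G r :=
    fun j => iInter_mem_eq_iInter_code H 𝒜 j
  simp only [e]
  exact h

end Inters

/-- **S₃⁺ FOR THE CO-SUNFLOWER OF THREE PRINCIPAL UP-SETS**: for all finite `b₀, b₁, b₂ ⊆ ι` and every product measure,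
`(κ+o)(κo−e₂) ≥ e₃` for the sandwiched triple `(↑b₁ ∪ ↑b₂, ↑b₀ ∪ ↑b₂, ↑b₀ ∪ ↑b₁)`, written `(⋃_{j≠k} ↑b_j)_k`. [this work] -/
theorem strongCubicPlus_nonneg_principal (q : ι → unitInterval) (b : Fin 3 → Finset ι) :
    0 ≤ strongCubicPlus q
      (⋃ (j : Fin 3) (_ : j ≠ 0), {ω : Set ι | (↑(b j) : Set ι) ⊆ ω})
      (⋃ (j : Fin 3) (_ : j ≠ 1), {ω : Set ι | (↑(b j) : Set ι) ⊆ ω})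
      (⋃ (j : Fin 3) (_ : j ≠ 2), {ω : Set ι | (↑(b j) : Set ι) ⊆ ω}) := by
  classical
  have hH : ∀ i : ι, DeterminedBy {ω : Set ι | i ∈ ω} (↑({i} : Finset ι) : Set ι) := fun i =>
    (determinedBy_iff _ _).2 fun ω ω' hωω' => by
      have h1 := Set.ext_iff.1 hωω' i
      simp only [Finset.coe_singleton, Set.mem_inter_iff, Set.mem_singleton_iff, and_true, Set.mem_setOf_eq] at h1 ⊢
      exact h1
  have h := strongCubicPlus_nonneg_coSunflower_inters (A := ι) q (fun i => {ω : Set ι | i ∈ ω}) (fun i => {i})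
    (fun a c hac => Finset.disjoint_singleton.2 hac) hH b
  have e : ∀ j : Fin 3, (⋂ i ∈ b j, {ω : Set ι | i ∈ ω}) = {ω : Set ι | (↑(b j) : Set ι) ⊆ ω} := by
    intro j; ext ω
    simp only [Set.mem_iInter, Set.mem_setOf_eq, Set.subset_def, Finset.mem_coe]
  simp only [e] at h
  exact h

/-- **S₃ `κo − e₂ ≥ e₃` for the co-sunflower of three principal up-sets**, every product measure. [this work] -/
theorem strongCubic_nonneg_principal (q : ι → unitInterval) (b : Fin 3 → Finset ι) :
    0 ≤ strongCubic q
      (⋃ (j : Fin 3) (_ : j ≠ 0), {ω : Set ι | (↑(b j) : Set ι) ⊆ ω})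
      (⋃ (j : Fin 3) (_ : j ≠ 1), {ω : Set ι | (↑(b j) : Set ι) ⊆ ω})
      (⋃ (j : Fin 3) (_ : j ≠ 2), {ω : Set ι | (↑(b j) : Set ι) ⊆ ω}) := by
  obtain ⟨hAB, hBA, hN⟩ := coFamily_sandwich (fun (j : Fin 3) (ω : Set ι) => (↑(b j) : Set ι) ⊆ ω)
  have e : ∀ k : Fin 3, (⋃ (j : Fin 3) (_ : j ≠ k), {ω : Set ι | (↑(b j) : Set ι) ⊆ ω}) = {ω | ∃ j : Fin 3, j ≠ k ∧ (↑(b j) : Set ι) ⊆ ω} := by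
    intro k; ext ω; simp only [Set.mem_iUnion, Set.mem_setOf_eq, exists_prop]
  have hA := isUpperSet_coPrincipal' b 0
  have hB := isUpperSet_coPrincipal' b 1
  have hN2 := isUpperSet_coPrincipal' b 2
  have h := strongCubicPlus_nonneg_principal q b
  rw [e 0] at hA h ⊢
  rw [e 1] at hB h ⊢
  rw [e 2] at hN2 h ⊢
  exact le_trans h (strongCubicPlus_le_strongCubic q hA hB hN2 hAB hBA hN)

end SahiS3PlusCert

end Summit.CriticalPhenomena.PercolationContinuityZ3.Theorems

end
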